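import Summits.KontsevichZagierPeriods.KontsevichZagierPeriods.Theorems.IsogenyCertificatesAlgebraicModuliRealPeriodCellTransferDatum
import Summits.KontsevichZagierPeriods.KontsevichZagierPeriods.Theorems.IsogenyCertificatesAlgebraicModuliRealPeriodCellTransferCellMove
import Summits.KontsevichZagierPeriods.KontsevichZagierPeriods.Theorems.IsogenyCertificatesAlgebraicModuliRealPeriodCellTransferCellCensus
import Summits.KontsevichZagierPeriods.KontsevichZagierPeriods.Theorems.IsogenyCertificatesAlgebraicModuliRealPeriodCellTransferCellImage
import Literature.NumberTheory.Transcendental.KZLogCalculusProofs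

/-!
# `AlgebraicModuliRealPeriodCell` (stmt-KontsevichZagierPeriods-18265), line `Sketch` — stub T
(`stub_algXMapTransfer`): the x-map period transfer for real-algebraic data

Port of the ℚ-line's crux proof `XMapPeriodTransferCells.XMapPeriodTransfer_of`
(Theorems/IsogenyCertificatesXMapPeriodTransfer.lean, line `saturated-sign-cells`) to real-algebraic
moduli `α, β, α', β'`, data `(f, g, c)` with real-algebraic coefficients and real-algebraic scalars:
WLOG `f, g` coprime (`TransferDatum.exists_isCoprime_datum`, reduction over the field `ℚ̄ ∩ ℝ`); the
cells of `{P > 0} ∖ {W = 0}` are mapped by `R = f/g` strictly monotonically onto WHOLE components of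
`{P' > 0}` (`TransferCellImage.cellImageComponent`); one rule-(2) move per cell
(`TransferCellMove.stub_cellMove`) and finite domain/integrand additivity give the census
`[K, a/√P] ≡ [U', (m_U a/|c|)/√P'] + [egg', (m_E a/|c|)/√P']` (`TransferCellCensus.cellCensus`, scalars in
`ℚ̄ ∩ ℝ`); the duplication datum on the target (`TransferDupDatum.stub_dupDatum`) pushes both `[r]` and
`[r']` onto `[U', γ/√P']`, `[U', γ'/√P']` with real-algebraic `γ, γ'`; soundness, `r.value = r'.value`
(used exactly once) and `∫_{U'} dx/√P' > 0` give `γ = γ'`.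

References: M. Kontsevich, D. Zagier, *Periods* (2001), §1.2; J. H. Silverman, *The Arithmetic of
Elliptic Curves* (2009), III.4–III.6; S. Basu, R. Pollack, M.-F. Roy, *Algorithms in Real Algebraic
Geometry* (2006), Thm. 5.22.
-/

noncomputable section

open Set Filter MeasureTheory Polynomial Topology
open Literature.NumberTheory.Transcendental
open Literature.ModelTheory.ExponentialFields (IsSemialgebraic)

namespace Summit.KontsevichZagierPeriods.IsogenyCertificates.AlgRealPeriodCell.Transfer

open TransferCellsBasic TransferCellImage TransferCellCensus

/-- **The transfer for a COPRIME real-algebraic datum.** [cite: KontsevichZagier2001, §1.2] -/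
theorem transfer_of_coprime (α β α' β' : ℝ) (hα : IsAlgebraic ℚ α) (hβ : IsAlgebraic ℚ β)
    (hα' : IsAlgebraic ℚ α') (hβ' : IsAlgebraic ℚ β') (hΔ' : 4 * α' ^ 3 + 27 * β' ^ 2 ≠ 0)
    (f g : ℝ[X]) (c : ℝ) (hf : ∀ n, IsAlgebraic ℚ (f.coeff n)) (hg : ∀ n, IsAlgebraic ℚ (g.coeff n))
    (hc : IsAlgebraic ℚ c) (hcop : IsCoprime f g) (hW : derivative f * g - f * derivative g ≠ 0)
    (hI : C (c ^ 2) * g * (f ^ 3 + C α' * f * g ^ 2 + C β' * g ^ 3) =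
      (X ^ 3 + C α * X + C β) * (derivative f * g - f * derivative g) ^ 2)
    (a b : ℝ) (ha : IsAlgebraic ℚ a) (hbalg : IsAlgebraic ℚ b) (hb : 0 < b) (r r' : KZ.IntegralRep 1)
    (h1 : r.domain = {x | 0 < x 0 ^ 3 + α * x 0 + β})
    (h2 : EqOn r.integrand (fun x => a / Real.sqrt (x 0 ^ 3 + α * x 0 + β)) r.domain)
    (h3 : r'.domain = {x | 0 < x 0 ^ 3 + α' * x 0 + β'})
    (h4 : EqOn r'.integrand (fun x => b / Real.sqrt (x 0 ^ 3 + α' * x 0 + β')) r'.domain)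
    (h5 : r.value = r'.value) : KZ.of r - KZ.of r' ∈ KZ.relations := by
  classical
  obtain ⟨-, hsaS, -, hsaU, hsaE, -, -⟩ := stub_cellsBasic
  obtain ⟨-, hc0⟩ := TransferDatum.g_ne_zero_and_c_ne_zero hW hI
  -- the scalars as elements of `K = ℚ̄ ∩ ℝ`
  have habs : IsAlgebraic ℚ |c| := by
    rcases abs_choice c with h | h
    · rw [h]; exact hc
    · rw [h]; exact hc.neg
  set aK : ↥(algebraicClosure ℚ ℝ) := ⟨a, mem_algebraicClosure_iff.2 ha⟩ with haK
  set bK : ↥(algebraicClosure ℚ ℝ) := ⟨b, mem_algebraicClosure_iff.2 hbalg⟩ with hbK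
  have habs₂ : IsAlgebraic ℚ |(2 : ℝ)| := by rw [abs_two]; exact TransferDupDatum.isAlgebraic_two
  set κ : ↥(algebraicClosure ℚ ℝ) := ⟨|c|⁻¹, mem_algebraicClosure_iff.2 habs.inv⟩ with hκ
  set κ₂ : ↥(algebraicClosure ℚ ℝ) := ⟨|(2 : ℝ)|⁻¹, mem_algebraicClosure_iff.2 habs₂.inv⟩ with hκ₂
  have hκv : (κ : ℝ) = |c|⁻¹ := rfl
  have hκ₂v : (κ₂ : ℝ) = |(2 : ℝ)|⁻¹ := rfl
  -- integrability of `dx/√P'` on `{P' > 0}`, inherited from `r'`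
  have hintP' : IntegrableOn (fun x : Fin 1 → ℝ => 1 / Real.sqrt (x 0 ^ 3 + α' * x 0 + β'))
      {x : Fin 1 → ℝ | 0 < x 0 ^ 3 + α' * x 0 + β'} :=
    PeriodRep.integrableOn_of_rep r' h3 h4 hb.ne'
  -- names for the objects of the line
  set S' : Set ℝ := {y : ℝ | 0 < y ^ 3 + α' * y + β'} with hS'
  set U' : Set ℝ := connectedComponentIn S' (1 + |α'| + |β'|) with hU'
  set E' : Set ℝ := S' \ U' with hE'
  set R : ℝ → ℝ := fun y => f.eval y / g.eval y with hR
  set W : ℝ → ℝ := fun y => (derivative f * g - f * derivative g).eval y with hWd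
  set L : Set ℝ := {y : ℝ | 0 < y ^ 3 + α * y + β ∧ (derivative f * g - f * derivative g).eval y ≠ 0}
    with hL
  have hL' : L = {y : ℝ | 0 < y ^ 3 + α * y + β ∧ W y ≠ 0} := by rw [hL]
  have hLsa : IsSemialgebraic ℚ {x : Fin 1 → ℝ | x 0 ∈ L} := by
    rw [hL]; exact isSemialgebraic_hat_cellLocus α β hα hβ f g hf hg
  -- the duplication datum on the target
  set f₂ : ℝ[X] := X ^ 4 - C (2 * α') * X ^ 2 - C (8 * β') * X + C (α' ^ 2) with hf₂
  set g₂ : ℝ[X] := C 4 * (X ^ 3 + C α' * X + C β') with hg₂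
  obtain ⟨hW₂, hI₂, -, -⟩ := TransferDupDatum.stub_dupDatum α' β' f₂ g₂ hf₂ hg₂
  obtain ⟨hf₂alg, hg₂alg⟩ := TransferDupDatum.dupDatum_coeff_isAlgebraic α' β' hα' hβ' f₂ g₂ hf₂ hg₂
  set R₂ : ℝ → ℝ := fun y => f₂.eval y / g₂.eval y with hR₂
  set W₂ : ℝ → ℝ := fun y => (derivative f₂ * g₂ - f₂ * derivative g₂).eval y with hW₂d
  set L₂ : Set ℝ := {y : ℝ | 0 < y ^ 3 + α' * y + β' ∧ (derivative f₂ * g₂ - f₂ * derivative g₂).eval y ≠ 0}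
    with hL₂
  have hL₂' : L₂ = {y : ℝ | 0 < y ^ 3 + α' * y + β' ∧ W₂ y ≠ 0} := by rw [hL₂]
  have hL₂sa : IsSemialgebraic ℚ {x : Fin 1 → ℝ | x 0 ∈ L₂} := by
    rw [hL₂]; exact isSemialgebraic_hat_cellLocus α' β' hα' hβ' f₂ g₂ hf₂alg hg₂alg
  have hU'S : U' ⊆ S' := connectedComponentIn_subset _ _
  have hE'S : E' ⊆ S' := Set.sdiff_subset
  have hUS : {x : Fin 1 → ℝ | x 0 ∈ U'} ⊆ {x : Fin 1 → ℝ | 0 < x 0 ^ 3 + α' * x 0 + β'} :=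
    fun x hx => hU'S hx
  have hES : {x : Fin 1 → ℝ | x 0 ∈ E'} ⊆ {x : Fin 1 → ℝ | 0 < x 0 ^ 3 + α' * x 0 + β'} :=
    fun x hx => hE'S hx
  -- the move hypothesis of the census from the per-cell moves, for a datum `(φ, ψ, c₀)`
  have move_of : ∀ (φ ψ : ℝ[X]) (c₀ : ℝ) (hφ : ∀ n, IsAlgebraic ℚ (φ.coeff n)) (hψ : ∀ n, IsAlgebraic ℚ (ψ.coeff n))
      (α₀ β₀ : ℝ) (hW₀ : derivative φ * ψ - φ * derivative ψ ≠ 0)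
      (hI₀ : C (c₀ ^ 2) * ψ * (φ ^ 3 + C α' * φ * ψ ^ 2 + C β' * ψ ^ 3) =
        (X ^ 3 + C α₀ * X + C β₀) * (derivative φ * ψ - φ * derivative ψ) ^ 2)
      (R₀ Wf : ℝ → ℝ) (L₀ : Set ℝ) (hR₀ : R₀ = fun y => φ.eval y / ψ.eval y)
      (hWf : Wf = fun y => (derivative φ * ψ - φ * derivative ψ).eval y)
      (hL₀ : L₀ = {y : ℝ | 0 < y ^ 3 + α₀ * y + β₀ ∧ Wf y ≠ 0})
      (κ₀ : ↥(algebraicClosure ℚ ℝ)) (hκ₀ : (κ₀ : ℝ) = |c₀|⁻¹)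
      (hinj : ∀ x₀ ∈ L₀, InjOn R₀ (connectedComponentIn L₀ x₀)) (K₀ : Set ℝ),
      ∀ x₀ ∈ L₀, x₀ ∈ K₀ → ∀ (s : ↥(algebraicClosure ℚ ℝ)) (rI t : KZ.IntegralRep 1),
        rI.domain = {x | x 0 ∈ connectedComponentIn L₀ x₀} →
        EqOn rI.integrand (fun x => (s : ℝ) / Real.sqrt (x 0 ^ 3 + α₀ * x 0 + β₀)) rI.domain →
        t.domain = {x | x 0 ∈ R₀ '' connectedComponentIn L₀ x₀} →
        EqOn t.integrand
          (fun x => ((s * κ₀ : ↥(algebraicClosure ℚ ℝ)) : ℝ) / Real.sqrt (x 0 ^ 3 + α' * x 0 + β')) t.domain →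
        KZ.of rI - KZ.of t ∈ KZ.relations := by
    intro φ ψ c₀ hφ hψ α₀ β₀ hW₀ hI₀ R₀ Wf L₀ hR₀ hWf hL₀ κ₀ hκ₀ hinj K₀ x₀ hx₀ _ s rI t hd he htd hte
    refine TransferCellMove.stub_cellMove α₀ β₀ α' β' φ ψ c₀ hφ hψ hW₀ hI₀ R₀ Wf L₀ hR₀ hWf hL₀ x₀ hx₀
      (hinj x₀ hx₀) (s : ℝ) rI t hd he htd fun x hx => ?_
    rw [hte hx]
    push_cast
    rw [hκ₀]
    ring
  -- CENSUS 1: the datum on the whole of `{P > 0}`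
  have himgc : ∀ x₀ ∈ L, InjOn R (connectedComponentIn L x₀) ∧
      (R '' connectedComponentIn L x₀ = U' ∨ (R '' connectedComponentIn L x₀ = E' ∧
        ∃ v : ℝ, v ^ 3 + α' * v + β' = 0 ∧ ∀ y ∈ R '' connectedComponentIn L x₀, y < v)) :=
    fun x₀ hx₀ => cellImageComponent α β α' β' f g c hΔ' hW hI hcop R W L hR hWd hL' U' E' hU' hE' x₀ hx₀
  obtain ⟨mU, mE, -, hcens⟩ := cellCensus α β α' β' hα' hβ' f g hW R W L hR hWd hL' hLsa U' E' hU' hE'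
    {y : ℝ | 0 < y ^ 3 + α * y + β} subset_rfl (hsaS α β hα hβ)
    (fun x₀ _ _ => cell_subset_pos α β f g x₀)
    (fun x₀ hx₀ _ => ⟨(himgc x₀ hx₀).1, (himgc x₀ hx₀).2.imp id And.left⟩)
    κ (move_of f g c hf hg α β hW hI R W L hR hWd hL' κ hκv (fun x₀ hx₀ => (himgc x₀ hx₀).1) _)
    hintP'
  -- CENSUS 2 and 3: the duplication datum on `U'` and on `E'`
  have hdup : ∀ {x₀ : ℝ}, x₀ ∈ L₂ → InjOn R₂ (connectedComponentIn L₂ x₀) ∧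
      R₂ '' connectedComponentIn L₂ x₀ = U' := fun hx₀ =>
    dup_cell_image α' β' hΔ' f₂ g₂ hf₂ hg₂ hx₀
  have dup_census : ∀ (K : Set ℝ), K ⊆ S' → IsSemialgebraic ℚ {x : Fin 1 → ℝ | x 0 ∈ K} →
      (∀ x₀ ∈ L₂, x₀ ∈ K → connectedComponentIn L₂ x₀ ⊆ K) →
      ∃ k : ℕ, ∀ (s : ↥(algebraicClosure ℚ ℝ)) (ρ : KZ.IntegralRep 1), ρ.domain = {x | x 0 ∈ K} →
        EqOn ρ.integrand (fun x => (s : ℝ) / Real.sqrt (x 0 ^ 3 + α' * x 0 + β')) ρ.domain →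
        ∃ u : KZ.IntegralRep 1, u.domain = {x | x 0 ∈ U'} ∧
          EqOn u.integrand
            (fun x => (((k : ↥(algebraicClosure ℚ ℝ)) * (s * κ₂) : ↥(algebraicClosure ℚ ℝ)) : ℝ) /
              Real.sqrt (x 0 ^ 3 + α' * x 0 + β')) u.domain ∧
          KZ.of ρ - KZ.of u ∈ KZ.relations := by
    intro K hK hKsa hKsat
    obtain ⟨kU, kE, hkE, hcK⟩ := cellCensus α' β' α' β' hα' hβ' f₂ g₂ hW₂ R₂ W₂ L₂ hR₂ hW₂d hL₂' hL₂sa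
      U' E' hU' hE' K hK hKsa hKsat (fun x₀ hx₀ _ => ⟨(hdup hx₀).1, Or.inl (hdup hx₀).2⟩)
      κ₂ (move_of f₂ g₂ 2 hf₂alg hg₂alg α' β' hW₂ hI₂ R₂ W₂ L₂ hR₂ hW₂d hL₂' κ₂ hκ₂v
        (fun x₀ hx₀ => (hdup hx₀).1) K) hintP'
    have hkE0 : kE = 0 := hkE fun x₀ hx₀ _ => (hdup hx₀).2
    refine ⟨kU, fun s ρ hρd hρe => ?_⟩
    obtain ⟨u, e, hud, hue, _, hee, hrel⟩ := hcK s ρ hρd hρe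
    have he0 : KZ.of e ∈ KZ.relations := by
      refine KZ.of_mem_relations_of_eqOn_zero e fun x hx => ?_
      rw [hee hx, hkE0]
      simp
    refine ⟨u, hud, hue, ?_⟩
    have : KZ.of ρ - KZ.of u = (KZ.of ρ - KZ.of u - KZ.of e) + KZ.of e := by abel
    rw [this]
    exact KZ.relations.add_mem hrel he0
  obtain ⟨kU, hcU⟩ := dup_census U' hU'S (hsaU α' β' hα' hβ')
    (fun x₀ hx₀ hK => cell_subset_unbounded α' β' f₂ g₂ hx₀ hK)
  obtain ⟨kE, hcE⟩ := dup_census E' hE'S (hsaE α' β' hα' hβ')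
    (fun x₀ hx₀ hK => cell_subset_egg α' β' f₂ g₂ hx₀ hK)
  -- push `[r]` to `U'`
  obtain ⟨u, e, hud, hue, hed, hee, hrel⟩ := hcens aK r h1 h2
  obtain ⟨u₁, hu₁d, hu₁e, hrel₁⟩ := hcU (mU * (aK * κ)) u hud hue
  obtain ⟨u₂, hu₂d, hu₂e, hrel₂⟩ := hcE (mE * (aK * κ)) e hed hee
  -- push `[r']` to `U'`
  have hUsub : {x : Fin 1 → ℝ | x 0 ∈ U'} ⊆ r'.domain := by rw [h3]; exact hUS
  have hEsub : {x : Fin 1 → ℝ | x 0 ∈ E'} ⊆ r'.domain := by rw [h3]; exact hES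
  set r'U : KZ.IntegralRep 1 := r'.restrict _ (hsaU α' β' hα' hβ') hUsub with hr'U
  set r'E : KZ.IntegralRep 1 := r'.restrict _ (hsaE α' β' hα' hβ') hEsub with hr'E
  have hsplit : KZ.of r' - KZ.of r'U - KZ.of r'E ∈ KZ.relations := by
    refine KZ.domainAddRel_subset_relations ⟨1, r', r'U, r'E, ?_, ?_, fun _ _ => rfl, fun _ _ => rfl, rfl⟩
    · rw [KZ.IntegralRep.domain_restrict, KZ.IntegralRep.domain_restrict, h3]
      ext x
      have hx : x ∈ ({x | x 0 ∈ U'} ∪ {x | x 0 ∈ E'} : Set (Fin 1 → ℝ)) ↔ x 0 ∈ U' ∪ E' := by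
        simp only [mem_union, mem_setOf_eq]
      rw [hx, hE', Set.union_sdiff_cancel hU'S]
      rfl
    · have he : r'U.domain ∩ r'E.domain = ∅ := by
        rw [KZ.IntegralRep.domain_restrict, KZ.IntegralRep.domain_restrict]
        ext x
        simp only [mem_inter_iff, mem_setOf_eq, mem_empty_iff_false, iff_false, not_and]
        exact fun hU hE => hE.2 hU
      rw [he, measure_empty]
  obtain ⟨u₃, hu₃d, hu₃e, hrel₃⟩ := hcU bK r'U (by rw [hr'U, KZ.IntegralRep.domain_restrict])
    (fun x hx => h4 (hUsub hx))
  obtain ⟨u₄, hu₄d, hu₄e, hrel₄⟩ := hcE bK r'E (by rw [hr'E, KZ.IntegralRep.domain_restrict])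
    (fun x hx => h4 (hEsub hx))
  -- merge on `U'`
  set γ : ↥(algebraicClosure ℚ ℝ) := kU * ((mU : ↥(algebraicClosure ℚ ℝ)) * (aK * κ) * κ₂) +
    kE * ((mE : ↥(algebraicClosure ℚ ℝ)) * (aK * κ) * κ₂) with hγ
  set γ' : ↥(algebraicClosure ℚ ℝ) := kU * (bK * κ₂) + kE * (bK * κ₂) with hγ'
  obtain ⟨TU, hTUd, hTUi⟩ := cellCensus_exists_rep hα' hβ' (hsaU α' β' hα' hβ') hUS hintP'
  have hmerge : KZ.of (TU γ) - KZ.of u₁ - KZ.of u₂ ∈ KZ.relations := by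
    refine KZ.integrandAddRel_subset_relations ⟨1, TU γ, u₁, u₂, hu₁d.trans (hTUd γ).symm,
      hu₂d.trans (hTUd γ).symm, fun x hx => ?_, rfl⟩
    rw [Pi.add_apply, hTUi, hu₁e (hu₁d.symm ▸ (hTUd γ) ▸ hx), hu₂e (hu₂d.symm ▸ (hTUd γ) ▸ hx), hγ]
    push_cast
    ring
  have hmerge' : KZ.of (TU γ') - KZ.of u₃ - KZ.of u₄ ∈ KZ.relations := by
    refine KZ.integrandAddRel_subset_relations ⟨1, TU γ', u₃, u₄, hu₃d.trans (hTUd γ').symm,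
      hu₄d.trans (hTUd γ').symm, fun x hx => ?_, rfl⟩
    rw [Pi.add_apply, hTUi, hu₃e (hu₃d.symm ▸ (hTUd γ') ▸ hx), hu₄e (hu₄d.symm ▸ (hTUd γ') ▸ hx), hγ']
    push_cast
    ring
  -- `[r] ≡ [V]` and `[r'] ≡ [V']`
  have hrV : KZ.of r - KZ.of (TU γ) ∈ KZ.relations := by
    have : KZ.of r - KZ.of (TU γ) = (KZ.of r - KZ.of u - KZ.of e) + (KZ.of u - KZ.of u₁) +
        (KZ.of e - KZ.of u₂) - (KZ.of (TU γ) - KZ.of u₁ - KZ.of u₂) := by abel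
    rw [this]
    exact KZ.relations.sub_mem (KZ.relations.add_mem (KZ.relations.add_mem hrel hrel₁) hrel₂) hmerge
  have hr'V' : KZ.of r' - KZ.of (TU γ') ∈ KZ.relations := by
    have : KZ.of r' - KZ.of (TU γ') = (KZ.of r' - KZ.of r'U - KZ.of r'E) + (KZ.of r'U - KZ.of u₃) +
        (KZ.of r'E - KZ.of u₄) - (KZ.of (TU γ') - KZ.of u₃ - KZ.of u₄) := by abel
    rw [this]
    exact KZ.relations.sub_mem (KZ.relations.add_mem (KZ.relations.add_mem hsplit hrel₃) hrel₄) hmerge'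
  -- the unique use of `r.value = r'.value`: the two scalars on `U'` agree
  have hΩ := unbounded_period_pos α' β' hintP'
  have hvV := value_rep (α := α') (β := β') (TU γ) (hTUd γ) (by rw [hTUi]; exact fun _ _ => rfl)
  have hvV' := value_rep (α := α') (β := β') (TU γ') (hTUd γ') (by rw [hTUi]; exact fun _ _ => rfl)
  have hγγ' : ((γ : ↥(algebraicClosure ℚ ℝ)) : ℝ) = γ' := by
    have e1 : (TU γ).value = (TU γ').value := by
      rw [← KZ.Equivalent.value_eq_holds hrV, ← KZ.Equivalent.value_eq_holds hr'V', h5]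
    rw [hvV, hvV'] at e1
    exact mul_right_cancel₀ hΩ.ne' e1
  have hVV' : KZ.of (TU γ) - KZ.of (TU γ') ∈ KZ.relations :=
    KZ.of_sub_of_mem_relations_of_eqOn ((hTUd γ').trans (hTUd γ).symm) fun x _ => by
      rw [hTUi, hTUi]
      simp only [hγγ']
  have : KZ.of r - KZ.of r' = (KZ.of r - KZ.of (TU γ)) + (KZ.of (TU γ) - KZ.of (TU γ')) -
      (KZ.of r' - KZ.of (TU γ')) := by abel
  rw [this]
  exact KZ.relations.sub_mem (KZ.relations.add_mem hrV hVV') hr'V'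

/-- **Stub T of line `Sketch` — the x-map period transfer for real-algebraic data**, by reduction to a
coprime datum over `ℚ̄ ∩ ℝ` (`TransferDatum.exists_isCoprime_datum`) and `transfer_of_coprime`.
[cite: KontsevichZagier2001, §1.2] -/
theorem stub_algXMapTransfer : ∀ (α β α' β' : ℝ), IsAlgebraic ℚ α → IsAlgebraic ℚ β → IsAlgebraic ℚ α' → IsAlgebraic ℚ β' → 4 * α ^ 3 + 27 * β ^ 2 ≠ 0 → 4 * α' ^ 3 + 27 * β' ^ 2 ≠ 0 → (∃ (f g : Polynomial ℝ) (c : ℝ), (∀ n, IsAlgebraic ℚ (f.coeff n)) ∧ (∀ n, IsAlgebraic ℚ (g.coeff n)) ∧ IsAlgebraic ℚ c ∧ Polynomial.derivative f * g - f * Polynomial.derivative g ≠ 0 ∧ Polynomial.C (c ^ 2) * g * (f ^ 3 + Polynomial.C α' * f * g ^ 2 + Polynomial.C β' * g ^ 3) = (Polynomial.X ^ 3 + Polynomial.C α * Polynomial.X + Polynomial.C β) * (Polynomial.derivative f * g - f * Polynomial.derivative g) ^ 2) → ∀ (a b : ℝ), IsAlgebraic ℚ a → IsAlgebraic ℚ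 b → 0 < a → 0 < b → ∀ (r r' : Literature.NumberTheory.Transcendental.KZ.IntegralRep 1), r.domain = {x | 0 < x 0 ^ 3 + α * x 0 + β} → Set.EqOn r.integrand (fun x => a / Real.sqrt (x 0 ^ 3 + α * x 0 + β)) r.domain → r'.domain = {x | 0 < x 0 ^ 3 + α' * x 0 + β'} → Set.EqOn r'.integrand (fun x => b / Real.sqrt (x 0 ^ 3 + α' * x 0 + β')) r'.domain → r.value = r'.value → Literature.NumberTheory.Transcendental.KZ.of r - Literature.NumberTheory.Transcendental.KZ.of r' ∈ Literature.NumberTheory.Transcendental.KZ.relations := by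
  rintro α β α' β' hα hβ hα' hβ' - hΔ' hD a b ha hbalg - hb r r' h1 h2 h3 h4 h5
  obtain ⟨f, g, c, hf, hg, hc, hcop, hW, hI⟩ := TransferDatum.exists_isCoprime_datum' hα hβ hα' hβ' hD
  exact transfer_of_coprime α β α' β' hα hβ hα' hβ' hΔ' f g c hf hg hc hcop hW hI a b ha hbalg hb r r'
    h1 h2 h3 h4 h5

end Summit.KontsevichZagierPeriods.IsogenyCertificates.AlgRealPeriodCell.Transfer

end
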